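import Literature.InformationTheory.QuantumCodes.DistanceFailureFloor
import Literature.InformationTheory.QuantumCodes.CSSPhenomenologicalConverse
import HarnessLib

/-!
# The distance floor survives noisy syndrome measurement: for EVERY space-time decoder, every number of rounds and
# every measurement-error rate, `½·C(d,⌈d/2⌉)·p^{⌈d/2⌉}(1−p)^{⌊d/2⌋} ≤ P^{ph}_fail(p, q)`

Topic `Literature/InformationTheory/QuantumCodes` (venture QEC, LADDER-QEC rungs Q4/Q5; qec-lit-2 gen 6). Theorem-only;
no definition, no named fact, no `sorry`. Companion of `DistanceFailureFloor.lean` (code capacity) for the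
phenomenological model of Dennis et al. §4.2 (`T` rounds of syndrome measurement; qubit faults at rate `p`,
measurement faults at rate `q`; the tree's `CSSPhenom.phenomFailureProb`).

Mechanism (the genie argument of `CSSPhenomenologicalConverse.lean`, §"Inserting one round of qubit faults"):
conditioning on all faults except the round-`t₀` qubit faults turns any space-time decoder into a code-capacity
decoder of those faults at rate `p` (`CSSPhenom.corrects_add_ins_iff`: "the record sees one round's qubit faults only
through their syndrome"), and the phenomenological failure probability is the corresponding MIXTURE of code-capacity
failure probabilities. Hence:

* `CSSPhenom.le_phenomFailureProb_of_forall_decoder` — any bound `c ≤ P_p[D' fails]` valid for EVERY code-capacity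
  decoder `D'` of the syndrome map `e ↦ He` (trivial set `SX`) is a bound `c ≤ P^{ph}_{p,q}[D fails]` for every
  space-time decoder `D`, every `T ≥ 1`, every `0 ≤ q ≤ 1`;
* **`CSSCode.distanceFloor_le_zPhenomFailureProb`** / `_le_xPhenomFailureProb` (`k ≥ 1`, `0 ≤ p ≤ 1/2`,
  `0 ≤ q ≤ 1`, `T ≥ 1`): `½·C(d,⌈d/2⌉)·p^{⌈d/2⌉}(1−p)^{⌊d/2⌋} ≤ P^{ph}_fail` — measurement data, however reliable
  (`q = 0` included), cannot beat the distance floor; cruder `½·p^{d}` forms;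
* families (`k_i ≥ 1`, rounds `T_i ≥ 1`, any measurement-rate schedule `q_i ∈ [0,1]`, ANY space-time decoder
  family): one below-threshold qubit rate `0 < p ≤ 1/2` forces `d^Z_i → ∞`
  (`tendsto_dZ_atTop_of_phenom_belowThreshold`; `X` twin); bounded distance ⇒ phenomenological accuracy
  threshold `0` at `q = p` (`zPhenom_accuracyThreshold_eq_zero_of_dZ_le`).

Not claimed: circuit-level noise; anything about specific decoders; numbers.

## References

* [DennisEtAl2002] E. Dennis, A. Kitaev, A. Landahl, J. Preskill, J. Math. Phys. 43 (2002) 4452, §3 (chunk p0010 L3: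
  "L/2 errors could suffice to cause damage"), §4.2 (error histories, rates p and q), §4.3, §5.2 (Prob_fail).
* [RichardsonUrbanke2008] T. Richardson, R. Urbanke, *Modern Coding Theory*, Lemma 4.78 (the genie / degradation
  pattern used by the tree's phenomenological converses).
-/

namespace Literature.InformationTheory.QuantumCodes

open Finset Matrix Filter Topology

/-! ### The mixture principle: every-decoder code-capacity floors are phenomenological floors -/

namespace CSSPhenom

variable {ι V : Type*} [Fintype ι] [DecidableEq ι] [Fintype V] [DecidableEq V] {T : ℕ}

open Classical in
/-- **Mixture principle.** For every check matrix `H`, trivial subspace `SX`, rounds `T ≥ 1` (`t₀ : Fin T`), EVERY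
space-time decoder `D`, qubit rate `0 ≤ p ≤ 1` and measurement rate `0 ≤ q ≤ 1`: if `c ≤ P_p[D' fails]` for EVERY
code-capacity decoder `D'` of the syndrome map `e ↦ He`, then `c ≤ P^{ph}_{p,q}[D fails]` (the phenomenological
failure probability is a mixture, over the faults off round `t₀`'s qubits, of code-capacity failure probabilities
of induced decoders). [cite: DennisEtAl2002, §4.2–4.3 and §5.2 (Prob_fail); RichardsonUrbanke2008, Lemma 4.78] -/
theorem le_phenomFailureProb_of_forall_decoder (H : Matrix ι V (ZMod 2)) (SX : Submodule (ZMod 2) (V → ZMod 2))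
    (D : STDecoder ι V T) (t₀ : Fin T) {p q c : ℝ} (hp0 : 0 ≤ p) (hp1 : p ≤ 1) (hq0 : 0 ≤ q) (hq1 : q ≤ 1)
    (hc : ∀ D' : Decoder (ι → ZMod 2) (V → ZMod 2),
      c ≤ ∑ e ∈ univ.filter (fun e : V → ZMod 2 =>
        ¬ D'.Corrects (fun e => H *ᵥ e) (SX : Set (V → ZMod 2)) e), bernoulliWeight p (supp e)) :
    c ≤ phenomFailureProb H T (SX : Set (V → ZMod 2)) D p q := by
  classical
  have hr0 : ∀ i : HistoryLoc V ι T, 0 ≤ phenomRate (Q := V) (C := ι) (T := T) p q i := by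
    rintro (_ | _) <;> simp [phenomRate, hp0, hq0]
  have hr1 : ∀ i : HistoryLoc V ι T, phenomRate (Q := V) (C := ι) (T := T) p q i ≤ 1 := by
    rintro (_ | _)
    · simp [phenomRate, hp1]
    · simp [phenomRate, hq1]
  -- the weight of the faults off round `t₀`'s qubits and its non-negativity
  have hw0 : ∀ E' : History ι V T, 0 ≤ (∏ i ∈ supp E', phenomRate (Q := V) (C := ι) (T := T) p q i) *
      ∏ i ∈ (univ \ (univ : Finset V).map ⟨fun v => (Sum.inl (v, t₀) : HistoryLoc V ι T),
          fun v w h => by simpa using h⟩) \ supp E', (1 - phenomRate (Q := V) (C := ι) (T := T) p q i) :=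
    fun E' => mul_nonneg (Finset.prod_nonneg fun i _ => hr0 i)
      (Finset.prod_nonneg fun i _ => sub_nonneg.2 (hr1 i))
  -- Step 1: the failure probability as a mixture of code-capacity failure probabilities
  have hph : phenomFailureProb H T (SX : Set (V → ZMod 2)) D p q =
      ∑ E' ∈ univ.filter (fun E' : History ι V T => ∀ v, E' (Sum.inl (v, t₀)) = 0),
        ((∏ i ∈ supp E', phenomRate (Q := V) (C := ι) (T := T) p q i) *
          ∏ i ∈ (univ \ (univ : Finset V).map ⟨fun v => (Sum.inl (v, t₀) : HistoryLoc V ι T),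
              fun v w h => by simpa using h⟩) \ supp E', (1 - phenomRate (Q := V) (C := ι) (T := T) p q i)) *
          ∑ e ∈ univ.filter (fun e : V → ZMod 2 => ¬ Decoder.Corrects
              (fun s : ι → ZMod 2 =>
                proj (D (stSyn H T E' + fun x => if x.2 = t₀.castSucc then s x.1 else 0)) + proj E')
              (fun e => H *ᵥ e) (SX : Set (V → ZMod 2)) e),
            bernoulliWeight p (supp e) := by
    unfold phenomFailureProb phenomenologicalWeight
    rw [Finset.sum_filter, sum_history_split t₀]
    refine Finset.sum_congr rfl fun E' hE' => ?_
    rw [Finset.mem_filter] at hE'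
    rw [Finset.sum_filter, Finset.mul_sum]
    refine Finset.sum_congr rfl fun e _ => ?_
    rw [corrects_add_ins_iff H (SX : Set (V → ZMod 2)) D t₀ E' e, indepWeight_supp_add_ins t₀ hE'.2 e p q]
    split_ifs <;> simp
  -- Step 2: the mixture weights sum to one
  have hmass : ∑ E' ∈ univ.filter (fun E' : History ι V T => ∀ v, E' (Sum.inl (v, t₀)) = 0),
      (∏ i ∈ supp E', phenomRate (Q := V) (C := ι) (T := T) p q i) *
        ∏ i ∈ (univ \ (univ : Finset V).map ⟨fun v => (Sum.inl (v, t₀) : HistoryLoc V ι T),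
            fun v w h => by simpa using h⟩) \ supp E', (1 - phenomRate (Q := V) (C := ι) (T := T) p q i) = 1 := by
    have h := sum_indepWeight_supp (X := HistoryLoc V ι T) (phenomRate (Q := V) (C := ι) (T := T) p q)
    rw [sum_history_split t₀] at h
    refine Eq.trans ?_ h
    refine Finset.sum_congr rfl fun E' hE' => ?_
    rw [Finset.mem_filter] at hE'
    rw [Finset.sum_congr rfl fun e _ => indepWeight_supp_add_ins t₀ hE'.2 e p q, ← Finset.mul_sum,
      sum_bernoulliWeight_supp, mul_one]
  -- Step 3: the every-decoder bound for each induced decoder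
  rw [hph]
  calc c = ∑ E' ∈ univ.filter (fun E' : History ι V T => ∀ v, E' (Sum.inl (v, t₀)) = 0),
          ((∏ i ∈ supp E', phenomRate (Q := V) (C := ι) (T := T) p q i) *
            ∏ i ∈ (univ \ (univ : Finset V).map ⟨fun v => (Sum.inl (v, t₀) : HistoryLoc V ι T),
                fun v w h => by simpa using h⟩) \ supp E', (1 - phenomRate (Q := V) (C := ι) (T := T) p q i)) *
            c := by
        rw [← Finset.sum_mul, hmass, one_mul]
    _ ≤ _ := by
        refine Finset.sum_le_sum fun E' _ => ?_
        exact mul_le_mul_of_nonneg_left (hc _) (hw0 E')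

end CSSPhenom

/-! ### One CSS code: the distance floor under noisy syndrome measurement -/

namespace CSSCode

open CSSPhenom

variable {RX RZ V : Type*} [Fintype V] [DecidableEq V] [Fintype RX] [DecidableEq RX] [Fintype RZ] [DecidableEq RZ]
  {T : ℕ}

omit [DecidableEq RZ] in
/-- **THE DISTANCE FLOOR UNDER NOISY MEASUREMENT (`Z`-sector).** For a CSS code with `k ≥ 1`, rounds `T ≥ 1`
(`t₀ : Fin T`), EVERY space-time decoder of the noisy `X`-syndrome record, qubit rate `0 ≤ p ≤ 1/2` and measurement
rate `0 ≤ q ≤ 1`: `½·C(d^Z,⌈d^Z/2⌉)·p^{⌈d^Z/2⌉}(1−p)^{⌊d^Z/2⌋} ≤ P^{ph,Z}_{p,q}[D fails]`.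
[cite: DennisEtAl2002, §3 (chunk p0010 L3) and §4.2–4.3, §5.2 (Prob_fail)] -/
theorem distanceFloor_le_zPhenomFailureProb (C : CSSCode RX RZ V) (hk : 0 < C.k) (D : STDecoder RX V T)
    (t₀ : Fin T) {p q : ℝ} (hp0 : 0 ≤ p) (hp : p ≤ 1 / 2) (hq0 : 0 ≤ q) (hq1 : q ≤ 1) :
    1 / 2 * ((C.dZ.choose ((C.dZ + 1) / 2) : ℝ) * (p ^ ((C.dZ + 1) / 2) * (1 - p) ^ (C.dZ / 2))) ≤
      phenomFailureProb C.HX T (C.rowSpZ : Set (V → ZMod 2)) D p q :=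
  le_phenomFailureProb_of_forall_decoder C.HX C.rowSpZ D t₀ hp0 (by linarith) hq0 hq1 fun D' =>
    C.distanceFloor_le_zFailure hk D' hp0 hp

omit [DecidableEq RX] in
/-- **The distance floor under noisy measurement, `X`-sector** (noisy `Z`-syndrome record, bit flips).
[cite: DennisEtAl2002, §3 (chunk p0010 L3) and §4.2–4.3, §5.2] -/
theorem distanceFloor_le_xPhenomFailureProb (C : CSSCode RX RZ V) (hk : 0 < C.k) (D : STDecoder RZ V T)
    (t₀ : Fin T) {p q : ℝ} (hp0 : 0 ≤ p) (hp : p ≤ 1 / 2) (hq0 : 0 ≤ q) (hq1 : q ≤ 1) :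
    1 / 2 * ((C.dX.choose ((C.dX + 1) / 2) : ℝ) * (p ^ ((C.dX + 1) / 2) * (1 - p) ^ (C.dX / 2))) ≤
      phenomFailureProb C.HZ T (C.rowSpX : Set (V → ZMod 2)) D p q :=
  le_phenomFailureProb_of_forall_decoder C.HZ C.rowSpX D t₀ hp0 (by linarith) hq0 hq1 fun D' =>
    C.distanceFloor_le_xFailure hk D' hp0 hp

omit [DecidableEq RZ] in
/-- Cruder: `½·p^{d^Z} ≤ P^{ph,Z}_{p,q}[D fails]` for every space-time decoder (`k ≥ 1`, `T ≥ 1`, `0 ≤ p ≤ 1/2`,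
`0 ≤ q ≤ 1`). [cite: DennisEtAl2002, §3 (chunk p0010 L3) and §5.2] -/
theorem half_pow_dZ_le_zPhenomFailureProb (C : CSSCode RX RZ V) (hk : 0 < C.k) (D : STDecoder RX V T)
    (t₀ : Fin T) {p q : ℝ} (hp0 : 0 ≤ p) (hp : p ≤ 1 / 2) (hq0 : 0 ≤ q) (hq1 : q ≤ 1) :
    1 / 2 * p ^ C.dZ ≤ phenomFailureProb C.HX T (C.rowSpZ : Set (V → ZMod 2)) D p q :=
  le_phenomFailureProb_of_forall_decoder C.HX C.rowSpZ D t₀ hp0 (by linarith) hq0 hq1 fun D' =>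
    C.half_pow_dZ_le_zFailure hk D' hp0 hp

omit [DecidableEq RX] in
/-- Cruder, `X`-sector: `½·p^{d^X} ≤ P^{ph,X}_{p,q}[D fails]`. [cite: DennisEtAl2002, §3 (chunk p0010 L3) and §5.2] -/
theorem half_pow_dX_le_xPhenomFailureProb (C : CSSCode RX RZ V) (hk : 0 < C.k) (D : STDecoder RZ V T)
    (t₀ : Fin T) {p q : ℝ} (hp0 : 0 ≤ p) (hp : p ≤ 1 / 2) (hq0 : 0 ≤ q) (hq1 : q ≤ 1) :
    1 / 2 * p ^ C.dX ≤ phenomFailureProb C.HZ T (C.rowSpX : Set (V → ZMod 2)) D p q :=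
  le_phenomFailureProb_of_forall_decoder C.HZ C.rowSpX D t₀ hp0 (by linarith) hq0 hq1 fun D' =>
    C.half_pow_dX_le_xFailure hk D' hp0 hp

end CSSCode

/-! ### Families under noisy measurement: a threshold forces `d → ∞` -/

section Families

open CSSPhenom

variable {RX RZ Q : ℕ → Type*} [∀ i, Fintype (Q i)] [∀ i, DecidableEq (Q i)] [∀ i, Fintype (RX i)]
  [∀ i, DecidableEq (RX i)] [∀ i, Fintype (RZ i)] [∀ i, DecidableEq (RZ i)]

omit [∀ i, DecidableEq (RZ i)] in
/-- **A PHENOMENOLOGICAL THRESHOLD FORCES `d^Z → ∞`.** For a family of CSS codes with `k_i ≥ 1`, rounds `T_i ≥ 1`,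
ANY measurement-rate schedule `q_i ∈ [0, 1]` and ANY space-time decoder family of the `Z`-sector: if some qubit
rate `0 < p ≤ 1/2` is below threshold, then `d^Z_i → ∞`. [cite: DennisEtAl2002, §4.3 (below threshold) and §3 (chunk p0010 L3), §5.2] -/
theorem tendsto_dZ_atTop_of_phenom_belowThreshold (C : ∀ i, CSSCode (RX i) (RZ i) (Q i))
    (hk : ∀ i, 0 < (C i).k) (T : ℕ → ℕ) (hT : ∀ i, 0 < T i) (DZ : ∀ i, STDecoder (RX i) (Q i) (T i))
    (q : ℕ → ℝ) (hq0 : ∀ i, 0 ≤ q i) (hq1 : ∀ i, q i ≤ 1) {p : ℝ} (hp0 : 0 < p) (hp : p ≤ 1 / 2)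
    (h : BelowThreshold
      (fun i p => phenomFailureProb (C i).HX (T i) ((C i).rowSpZ : Set (Q i → ZMod 2)) (DZ i) p (q i)) p) :
    Tendsto (fun i => (C i).dZ) atTop atTop := by
  unfold BelowThreshold at h
  rw [tendsto_atTop]
  intro w
  have hc : (0 : ℝ) < 1 / 2 * p ^ w := by positivity
  refine (h.eventually (gt_mem_nhds hc)).mono fun i hi => ?_
  by_contra hlt
  push Not at hlt
  have h1 := (C i).half_pow_dZ_le_zPhenomFailureProb (hk i) (DZ i) ⟨0, hT i⟩ hp0.le hp (hq0 i) (hq1 i)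
  have hmono : p ^ w ≤ p ^ (C i).dZ := pow_le_pow_of_le_one hp0.le (by linarith) hlt.le
  have hi' : phenomFailureProb (C i).HX (T i) ((C i).rowSpZ : Set (Q i → ZMod 2)) (DZ i) p (q i) <
      1 / 2 * p ^ w := hi
  linarith

omit [∀ i, DecidableEq (RX i)] in
/-- **A phenomenological threshold forces `d^X → ∞`** (`X`-sector, any space-time decoder family of the noisy
`Z`-syndrome record, any measurement-rate schedule). [cite: DennisEtAl2002, §4.3 and §3 (chunk p0010 L3), §5.2] -/
theorem tendsto_dX_atTop_of_phenom_belowThreshold (C : ∀ i, CSSCode (RX i) (RZ i) (Q i))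
    (hk : ∀ i, 0 < (C i).k) (T : ℕ → ℕ) (hT : ∀ i, 0 < T i) (DX : ∀ i, STDecoder (RZ i) (Q i) (T i))
    (q : ℕ → ℝ) (hq0 : ∀ i, 0 ≤ q i) (hq1 : ∀ i, q i ≤ 1) {p : ℝ} (hp0 : 0 < p) (hp : p ≤ 1 / 2)
    (h : BelowThreshold
      (fun i p => phenomFailureProb (C i).HZ (T i) ((C i).rowSpX : Set (Q i → ZMod 2)) (DX i) p (q i)) p) :
    Tendsto (fun i => (C i).dX) atTop atTop := by
  have h' := tendsto_dZ_atTop_of_phenom_belowThreshold (fun i => (C i).swap)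
    (fun i => by rw [CSSCode.k_swap]; exact hk i) T hT DX q hq0 hq1 hp0 hp h
  simpa only [CSSCode.dZ_swap] using h'

omit [∀ i, DecidableEq (RZ i)] in
/-- **Bounded distance ⇒ phenomenological accuracy threshold `0`** (`q = p`; `k_i ≥ 1`, `T_i ≥ 1`, `d^Z_i ≤ w`,
any space-time decoder family). [cite: DennisEtAl2002, §4.6 (p_c), §5.3 (p = q) and §3 (chunk p0010 L3)] -/
theorem zPhenom_accuracyThreshold_eq_zero_of_dZ_le (C : ∀ i, CSSCode (RX i) (RZ i) (Q i)) (hk : ∀ i, 0 < (C i).k)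
    (T : ℕ → ℕ) (hT : ∀ i, 0 < T i) (DZ : ∀ i, STDecoder (RX i) (Q i) (T i)) {w : ℕ} (hw : ∀ i, (C i).dZ ≤ w) :
    accuracyThreshold
      (fun i p => phenomFailureProb (C i).HX (T i) ((C i).rowSpZ : Set (Q i → ZMod 2)) (DZ i) p p) = 0 := by
  refine accuracyThreshold_eq_zero_of_not_belowThreshold fun p hp0 hp => ?_
  refine not_belowThreshold_of_le (c := 1 / 2 * p ^ w) (by positivity) fun i => ?_
  have h := (C i).half_pow_dZ_le_zPhenomFailureProb (hk i) (DZ i) ⟨0, hT i⟩ hp0.le hp hp0.le (by linarith)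
  have hmono : p ^ w ≤ p ^ (C i).dZ := pow_le_pow_of_le_one hp0.le (by linarith) (hw i)
  linarith

end Families

end Literature.InformationTheory.QuantumCodes
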